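import Summits.QuantumAdvantage.QuantumAdvantage.Theses.DarkClassGroups
import Literature.Computability.Cryptography.HallgrenClassGroup
import Literature.Computability.Cryptography.HallgrenClassGroupDiscriminant
import HarnessLib.Audit

/-!
# Line `cox-conductor` — piece P3 `OrderClassNumberFormula` of the BC2 redirect of
# `DarkClassGroups.ClassNumberFBQP` (stmt-QuantumAdvantage-11623) — skeleton v1

Planner `planner-cstrat-stmt-QuantumAdvantage-11623-r1-0` (crux-strategist, RESTATED re-audit, 2026-08-17).

THE PIECE (verbatim the child statement; local stand-in until the split is materialised): Cox, *Primes of the form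
x² + ny²*, Thm 7.24 with Thm 7.7(ii), on the tree's form-count `classNumber` (number of reduced primitive positive
definite forms): for `−d` fundamental and `f ≥ 1`,
  `h(−d f²) · w(−d) = h(−d) · w(−d f²) · ∏_{p^k ∥ f} p^{k−1} (p − χ_{−d}(p))`,
`w(−3) = 6, w(−4) = 4, w = 2` otherwise (so `[𝓞_K^× : 𝓞^×] = w(−d)/w(−df²)`), and the Kronecker symbol written
self-containedly as `χ_{−d}(p) = #{b mod 2p : b² ≡ −d (mod 4p)} − 1` (number of prime forms `(p, b, ·)` minus one;
checked against the Legendre/Kronecker values for odd `p ∤ d`, `p ∣ d`, and `p = 2` with `−d ≡ 1, 5 (mod 8)`,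
`−d ≡ 8, 12 (mod 16)`).  Brute-force sanity (planner, p3check.py): 752 pairs `(d, f)`, `d < 400` fundamental,
`d f² ≤ 6000`: 0 mismatches.  Also serves crux 4 `ClassNumberDominatesFactoring` (stmt-QuantumAdvantage-11057: the
φ-trick `h((1−4N)N²) = φ(N) h(1−4N)` is the instance `d = 4N−1`, all `p ∣ N` split) — NOT in Mathlib, NOT in the tree
(`ReducedFormsNonmaximalProofs.lean` avoids Thm 7.24 on purpose).

THE LINE (Cox §7.C–D: proper ideals of the order `𝓞 = ℤ + f𝓞_K`, the exact sequence
`1 → 𝓞_K^×/𝓞^× → (𝓞_K/f𝓞_K)^× / (ℤ/fℤ)^× → Pic 𝓞 → Pic 𝓞_K → 1`, and `C(D) ≅ Pic 𝓞` (Thm 7.7)):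
* S1 `stub_picardIndex` [L, LOAD-BEARING] — the index identity in integers:
  `h(−df²) · w(−d) · φ(f) = h(−d) · w(−df²) · |(𝓞_K/f𝓞_K)^×|` for any quadratic `K` of discriminant `−d`
  (form side: `HallgrenClassGroupOrder*.lean` already builds the form class group `Cl(O_D)` of an ARBITRARY negative
  discriminant and `IsNegFundamentalDiscr.classNumber_eq` identifies `h(−d)` with `h_K`; the new content is the
  conductor-`f` comparison map `C(−df²) → C(−d)` / `(a, b, c) ↦` class of `(a, bf⁻¹…)`, Cox Prop 7.20, Thm 7.24).
* S2 `stub_unitsQuotCard` [M] — `|(𝓞_K/f𝓞_K)^×| = φ(f) · ∏_{p^k ∥ f} p^{k−1} (p − χ_{−d}(p))` (CRT over `p^k ∥ f`;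
  `𝓞_K/p` is `𝔽_p²`, `𝔽_p × 𝔽_p` or `𝔽_p[ε]` according as `χ_{−d}(p) = −1, +1, 0`, read off the number of
  prime forms above `p` = number of ideals of norm `p` = `1 + χ`: `HallgrenClassGroupIdealEnumeration.localCount`,
  `card_ideals_absNorm_eq_le_card_divisors`-type dictionary).
COMPOSITION `OrderClassNumberFormula_of` (kernel-checked): take `K` from `IsNegFundamentalDiscr.exists_numberField`,
substitute S2 into S1 and cancel `φ(f) ≠ 0`.

HONEST LABEL. S1 and S2 are each strictly weaker than the piece (S1 leaves the unit-group count symbolic, S2 is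
pure finite-ring arithmetic); neither mentions algorithms, the crux or the summit.  No Disproof.lean for stmt-11623;
negatives index unrelated.
-/

noncomputable section

set_option linter.dupNamespace false

namespace Summit.QuantumAdvantage.QuantumAdvantage.Cruxes.OrderClassNumberFormula.Birth

/-- THE PIECE (byte-identical stand-in for the route decl `DarkClassGroups.OrderClassNumberFormula`). -/
def OrderClassNumberFormula : Prop :=
  ∀ d f : ℕ, (((-(d : ℤ)) % 4 = 1 ∧ Squarefree (-(d : ℤ)) ∧ (-(d : ℤ)) ≠ 1) ∨ (4 ∣ (-(d : ℤ)) ∧ ((-(d : ℤ)) / 4 % 4 = 2 ∨ (-(d : ℤ)) / 4 % 4 = 3) ∧ Squarefree ((-(d : ℤ)) / 4))) → 1 ≤ f → (Literature.NumberTheory.QuadraticFields.BinaryQuadraticForm.classNumber (-((d * f ^ 2 : ℕ) : ℤ)) : ℤ) * (if d = 3 then 6 else if d = 4 then 4 else 2) = (Literature.NumberTheory.QuadraticFields.BinaryQuadraticForm.classNumber (-(d : ℤ)) : ℤ) * (if d * f ^ 2 = 3 then 6 else if d * f ^ 2 = 4 then 4 else 2) * ∏ p ∈ f.primeFactors, ((p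 : ℤ) ^ (f.factorization p - 1) * ((p : ℤ) - ((Set.ncard {b : ℕ | b < 2 * p ∧ (4 * (p : ℤ)) ∣ ((b : ℤ) ^ 2 + (d : ℤ))} : ℤ) - 1)))

/-! ## Registered stubs — `sorry` lives ONLY in these two theorems -/

/-- Stub S1 `stub_picardIndex` [L, load-bearing]: Cox Thm 7.24's index identity with the unit-group count left
symbolic. -/
theorem stub_picardIndex : ∀ d f : ℕ, Literature.Computability.Cryptography.IsNegFundamentalDiscr d → 1 ≤ f →
    ∀ (K : Type) [Field K] [NumberField K], Module.finrank ℚ K = 2 → NumberField.discr K = -(d : ℤ) →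
      (Literature.NumberTheory.QuadraticFields.BinaryQuadraticForm.classNumber (-((d * f ^ 2 : ℕ) : ℤ)) : ℤ) * (if d = 3 then 6 else if d = 4 then 4 else 2) * (Nat.totient f : ℤ) = (Literature.NumberTheory.QuadraticFields.BinaryQuadraticForm.classNumber (-(d : ℤ)) : ℤ) * (if d * f ^ 2 = 3 then 6 else if d * f ^ 2 = 4 then 4 else 2) * (Nat.card ((NumberField.RingOfIntegers K ⧸ Ideal.span {((f : ℕ) : NumberField.RingOfIntegers K)})ˣ) : ℤ) := by
  sorry

/-- Stub S2 `stub_unitsQuotCard` [M]: the order of `(𝓞_K/f𝓞_K)^×` for a quadratic field, prime by prime. -/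
theorem stub_unitsQuotCard : ∀ d f : ℕ, Literature.Computability.Cryptography.IsNegFundamentalDiscr d → 1 ≤ f →
    ∀ (K : Type) [Field K] [NumberField K], Module.finrank ℚ K = 2 → NumberField.discr K = -(d : ℤ) →
      (Nat.card ((NumberField.RingOfIntegers K ⧸ Ideal.span {((f : ℕ) : NumberField.RingOfIntegers K)})ˣ) : ℤ) = (Nat.totient f : ℤ) * ∏ p ∈ f.primeFactors, ((p : ℤ) ^ (f.factorization p - 1) * ((p : ℤ) - ((Set.ncard {b : ℕ | b < 2 * p ∧ (4 * (p : ℤ)) ∣ ((b : ℤ) ^ 2 + (d : ℤ))} : ℤ) - 1))) := by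
  sorry

/-! ### Name-keyed aliases of the stub STATEMENTS -/
namespace Registered

/-- Statement of S1. -/
abbrev stub_picardIndex : Prop := ∀ d f : ℕ, Literature.Computability.Cryptography.IsNegFundamentalDiscr d → 1 ≤ f →
    ∀ (K : Type) [Field K] [NumberField K], Module.finrank ℚ K = 2 → NumberField.discr K = -(d : ℤ) →
      (Literature.NumberTheory.QuadraticFields.BinaryQuadraticForm.classNumber (-((d * f ^ 2 : ℕ) : ℤ)) : ℤ) * (if d = 3 then 6 else if d = 4 then 4 else 2) * (Nat.totient f : ℤ) = (Literature.NumberTheory.QuadraticFields.BinaryQuadraticForm.classNumber (-(d : ℤ)) : ℤ) * (if d * f ^ 2 = 3 then 6 else if d * f ^ 2 = 4 then 4 else 2) * (Nat.card ((NumberField.RingOfIntegers K ⧸ Ideal.span {((f : ℕ) : NumberField.RingOfIntegers K)})ˣ) : ℤ)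
/-- Statement of S2. -/
abbrev stub_unitsQuotCard : Prop := ∀ d f : ℕ, Literature.Computability.Cryptography.IsNegFundamentalDiscr d → 1 ≤ f →
    ∀ (K : Type) [Field K] [NumberField K], Module.finrank ℚ K = 2 → NumberField.discr K = -(d : ℤ) →
      (Nat.card ((NumberField.RingOfIntegers K ⧸ Ideal.span {((f : ℕ) : NumberField.RingOfIntegers K)})ˣ) : ℤ) = (Nat.totient f : ℤ) * ∏ p ∈ f.primeFactors, ((p : ℤ) ^ (f.factorization p - 1) * ((p : ℤ) - ((Set.ncard {b : ℕ | b < 2 * p ∧ (4 * (p : ℤ)) ∣ ((b : ℤ) ^ 2 + (d : ℤ))} : ℤ) - 1)))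

end Registered

/-! ## The composition (kernel-checked; no `sorry` below) -/

/-- **`OrderClassNumberFormula_of`**: S1 with S2 substituted, `φ(f)` cancelled. -/
theorem OrderClassNumberFormula_of (h1 : Registered.stub_picardIndex) (h2 : Registered.stub_unitsQuotCard) :
    OrderClassNumberFormula := by
  intro d f hd hf
  have hd' : Literature.Computability.Cryptography.IsNegFundamentalDiscr d := hd
  obtain ⟨K, _, _, h2K, hdisc⟩ := hd'.exists_numberField
  have e1 := h1 d f hd' hf K h2K hdisc
  have e2 := h2 d f hd' hf K h2K hdisc
  rw [e2] at e1
  have hφ : (Nat.totient f : ℤ) ≠ 0 := by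
    have : 0 < Nat.totient f := Nat.totient_pos.mpr (by omega)
    exact_mod_cast this.ne'
  refine mul_right_cancel₀ hφ ?_
  rw [e1]
  ring

/-- Wiring check. -/
example : OrderClassNumberFormula := OrderClassNumberFormula_of stub_picardIndex stub_unitsQuotCard

end Summit.QuantumAdvantage.QuantumAdvantage.Cruxes.OrderClassNumberFormula.Birth

end
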